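import Summits.Ventures.HodgeRepro.Night4ReducedDimQuadC14rPart1

/-!
# Beyond the census faces in degree 14: the complete table of the cyclic field `C14` of degree 14, part 4

Blind re-derivation cell `pub-hodge-repro`, seat `night-4` (ROUTE HARDENING for the Monday FINAL, gen 6).  Target tree
path `lean/Summits/Ventures/HodgeRepro/Night4ReducedDimQuadC14rPart4.lean`.

Three kernel half-rows of the table of `Night4ReducedDimQuadC14r.lean` (the representatives of the double classes
`night4Bases_C14r` of `…C14rPart1.lean`; each half-row = one base corner against the 64 types containing `1` or against their
conjugates) — a file of its own so that every file stays within the farm's build budget.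
Nothing here says anything about the status of the Hodge conjecture for CM abelian varieties, which is NOT proved.
-/

set_option autoImplicit false

open Finset
open scoped Pointwise

namespace HodgeRepro

/-! ## Half-rows — KERNEL -/

/-- Row 4, first half: the base corner `night4Type_C14 [0, 1, 2, 4, 5, 6, 10]`, the second corner over the types containing `1`. -/
theorem night4QuadRow_C14r_4a : quadRow cc_night4C14 night4Key_C14r (night4QuadPred night4QuadVals_C14r)
    night4Types_C14 (night4Type_C14 [0, 1, 2, 4, 5, 6, 10]) = true := by
  decide +kernel

/-- Row 4, second half: the second corner over the conjugates. -/
theorem night4QuadRow_C14r_4b : quadRow cc_night4C14 night4Key_C14r (night4QuadPred night4QuadVals_C14r)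
    (night4Types_C14.map (cc_night4C14 • ·)) (night4Type_C14 [0, 1, 2, 4, 5, 6, 10]) = true := by
  decide +kernel

/-- Row 5, first half: the base corner `night4Type_C14 [0, 2, 4, 5, 6, 8, 10]`, the second corner over the types containing `1`. -/
theorem night4QuadRow_C14r_5a : quadRow cc_night4C14 night4Key_C14r (night4QuadPred night4QuadVals_C14r)
    night4Types_C14 (night4Type_C14 [0, 2, 4, 5, 6, 8, 10]) = true := by
  decide +kernel

end HodgeRepro
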